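import Summits.Ventures.PercRepro.RankLevelSetHallLostInjColoop

/-!
# PercRepro — THE ONE-ELEMENT REDUCTION OF THE LOST-SET INJECTION, WITHOUT ANY RANK HYPOTHESIS: AN ELEMENT `e` OUTSIDE
THE CLOSURE OF EVERY LOST SET REDUCES `(INJ)` AT `(p, q)` TO `(INJ)` FOR `M ＼ e` AT `(p − 1, q)`; ITERATED OVER A SET `C`
OF ELEMENTS OUTSIDE THE CLOSURE OF EVERY FAT RANK-`q` SET, `(INJ)` AND THE UP-HALL FORM OF C-044 FOLLOW FROM `#C ≥ p − q − 1`
(p4, gen 34; C-044, UP form at the tight layer; paper proofs/P4-CELL-THREE.md §14.21)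

The coloop reduction (`RankLevelSetHallLostInjColoop`) uses of the coloop `e` only that it lies in no lost set and adds one
to the rank of every set it is adjoined to.  Here the same injection — `S ↦ insert e S` on the lost sets of size `p − 1`,
`S ↦ insert e (φ' S)` on the smaller ones, `φ'` an injection for `M ＼ {e}` at `(p − 1, q)` — is shown to work for EVERY
`e ∈ E` outside the closure of every lost set (`lostInj_of_notMem_closure`), with no hypothesis on the rank of `M`: the
members of `M` avoiding `e` are members of `M ＼ {e}` at `(p − 1, q)` because their complements are independent `p`-sets,
`insert e T` raises the rank by at most one (`eRk_insert_le_add_one`), and `insert e S` has rank exactly `q + 1`.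
Iterating over a set `C` with `Disjoint (cl S) C` for every fat rank-`q` set `S` (`r(S) = q < #S`) — a condition stable
under deletion — gives `(INJ)` whenever `p ≤ q + 1 + #C` (`lostInj_of_fatFree`), and the UP-Hall form
(`hallUp_of_ncard_eq_of_fatFree`).  The uniform model `T_p(U_{q,q+m} ⊕ U_{c,c})` has this property for `C` = the free
elements (its fat rank-`q` sets lie in the big flat), so `(INJ)` holds there — by a mechanism independent of Rule BIN.
* `mem_cellMembers_delete_of_notMem`, `mem_lostSets_delete_of_notMem_closure`, `insert_mem_bigY_of_mem_bigY_delete'`,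
  `insert_mem_bigY_of_notMem_closure`;
* **`lostInj_of_notMem_closure`** — `#E = p + q`, `e ∈ E`, `e ∉ cl S` for every lost `S`, `LostInj (M ＼ {e}) (p − 1) q` ⇒ `LostInj M p q`;
* **`lostInj_of_fatFree`**, **`hallUp_of_ncard_eq_of_fatFree`** — the iteration and the UP-Hall form.
Axioms: standard.
-/

namespace PercRepro

open Set Matroid

variable {α : Type} (M : Matroid α) [M.Finite]

/-- A member of `M` avoiding `e` is a member of `M ＼ {e}` at the cell `(p − 1, q)`: its complement is an independent
`p`-set, so removing `e` from it lowers the rank by exactly one. -/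
theorem mem_cellMembers_delete_of_notMem {p q : ℕ} (hE : M.E.ncard = p + q) {e : α} (heE : e ∈ M.E) {Z : Set α}
    (hZ : Z ∈ cellMembers M p q) (heZ : e ∉ Z) : Z ∈ cellMembers (M ＼ {e}) (p - 1) q := by
  obtain ⟨hind, hcard⟩ := compl_indep_of_mem_U M hE hZ
  obtain ⟨hZE, hZq, -⟩ := hZ
  have hZE' : Z ⊆ M.E \ {e} := subset_sdiff_singleton hZE heZ
  refine ⟨by rwa [delete_ground], ?_, ?_⟩
  · rw [eRk_delete_of_subset M hZE', hZq]
  · rw [delete_ground, eRk_delete_of_subset M sdiff_subset]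
    have hsub : (M.E \ {e}) \ Z ⊆ M.E \ Z := fun x hx => ⟨hx.1.1, hx.2⟩
    have hind' : M.Indep ((M.E \ {e}) \ Z) := hind.subset hsub
    have hfin : ((M.E \ {e}) \ Z).Finite := (M.set_finite M.E).subset (fun x hx => hx.1.1)
    rw [hind'.eRk_eq_encard, ← hfin.cast_ncard_eq]
    congr 1
    have heA : e ∈ M.E \ Z := ⟨heE, heZ⟩
    have hdiff : (M.E \ {e}) \ Z = (M.E \ Z) \ {e} := by
      ext x; simp only [mem_sdiff, mem_singleton_iff]; tauto
    rw [hdiff, ncard_sdiff_singleton_of_mem heA, hcard]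

/-- A lost set of `M` of size `< p − 1` avoiding the closure-free element `e` is a lost set of `M ＼ {e}` at `(p − 1, q)`. -/
theorem mem_lostSets_delete_of_notMem_closure {p q : ℕ} (hE : M.E.ncard = p + q) {e : α} (heE : e ∈ M.E) {S : Set α}
    (hS : S ∈ lostSets M p q) (heS : e ∉ M.closure S) (hcard : S.ncard < p - 1) :
    S ∈ lostSets (M ＼ {e}) (p - 1) q := by
  obtain ⟨hSE, hSq, hqS, -, Z, hZ, hZS⟩ := hS
  have heS' : e ∉ S := fun h => heS (M.subset_closure S hSE h)
  have hSE' : S ⊆ M.E \ {e} := subset_sdiff_singleton hSE heS'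
  refine ⟨by rwa [delete_ground], by rw [eRk_delete_of_subset M hSE', hSq], hqS, hcard, Z, ?_, hZS⟩
  exact mem_cellMembers_delete_of_notMem M hE heE hZ (fun h => heS' (hZS h))

/-- `T ↦ insert e T` sends the big `Y`-sets of `M ＼ {e}` at `(p − 1, q)` to big `Y`-sets of `M` at `(p, q)`, for ANY
`e ∈ E`: the rank goes up by at most one. -/
theorem insert_mem_bigY_of_mem_bigY_delete' {p q : ℕ} {e : α} (heE : e ∈ M.E) {T : Set α}
    (hT : T ∈ bigY (M ＼ {e}) (p - 1) q) : insert e T ∈ bigY M p q := by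
  obtain ⟨⟨hTE, hqT, hTp⟩, hcard⟩ := hT
  rw [delete_ground] at hTE
  have heT : e ∉ T := fun h => (hTE h).2 rfl
  have hTE' : T ⊆ M.E := hTE.trans sdiff_subset
  have hTfin : T.Finite := (M.set_finite M.E).subset hTE'
  rw [eRk_delete_of_subset M hTE] at hqT hTp
  have hTtop : M.eRk T ≠ ⊤ := ((M.eRk_le_encard T).trans_lt hTfin.encard_lt_top).ne
  obtain ⟨n, hn⟩ : ∃ n : ℕ, M.eRk T = n := ⟨(M.eRk T).toNat, (ENat.coe_toNat hTtop).symm⟩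
  rw [hn] at hqT hTp
  have hqn : q < n := by exact_mod_cast hqT
  have hnp : n < p - 1 := by exact_mod_cast hTp
  have hle : M.eRk (insert e T) ≤ M.eRk T + 1 := M.eRk_insert_le_add_one e T
  have hge : M.eRk T ≤ M.eRk (insert e T) := M.eRk_mono (subset_insert e T)
  rw [hn] at hle hge
  refine ⟨⟨insert_subset heE hTE', ?_, ?_⟩, ?_⟩
  · exact lt_of_lt_of_le hqT hge
  · refine lt_of_le_of_lt hle ?_
    rw [← Nat.cast_succ]
    exact_mod_cast (by omega : n + 1 < p)
  · rw [ncard_insert_of_notMem heT hTfin]; omega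

/-- A lost set of size `p − 1` becomes a big `Y`-set by adjoining an element outside its closure (rank `q + 1`, size `p`). -/
theorem insert_mem_bigY_of_notMem_closure {p q : ℕ} {e : α} (heE : e ∈ M.E) {S : Set α} (hS : S ∈ lostSets M p q)
    (heS : e ∉ M.closure S) (hcard : S.ncard = p - 1) : insert e S ∈ bigY M p q := by
  obtain ⟨hSE, hSq, hqS, hSp, -⟩ := hS
  have heS' : e ∉ S := fun h => heS (M.subset_closure S hSE h)
  have hSfin : S.Finite := (M.set_finite M.E).subset hSE
  have hins : M.eRk (insert e S) = (q : ℕ∞) + 1 := by rw [eRk_insert_eq_add_one ⟨heE, heS⟩, hSq]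
  refine ⟨⟨insert_subset heE hSE, ?_, ?_⟩, ?_⟩
  · rw [hins, ← Nat.cast_succ]; exact_mod_cast (by omega : q < q + 1)
  · rw [hins, ← Nat.cast_succ]; exact_mod_cast (by omega : q + 1 < p)
  · rw [ncard_insert_of_notMem heS' hSfin]; omega

/-- **The one-element reduction of (INJ)** (no rank hypothesis): at the tight layer `#E = p + q`, if `e ∈ E` lies outside
the closure of every lost set and `M ＼ {e}` satisfies `(INJ)` at `(p − 1, q)`, then `M` satisfies `(INJ)` at `(p, q)`. -/
theorem lostInj_of_notMem_closure {p q : ℕ} (hE : M.E.ncard = p + q) {e : α} (heE : e ∈ M.E)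
    (he : ∀ S ∈ lostSets M p q, e ∉ M.closure S) (h : LostInj (M ＼ {e}) (p - 1) q) : LostInj M p q := by
  classical
  obtain ⟨φ', hφ', hinj'⟩ := h
  have hnot : ∀ S ∈ lostSets M p q, e ∉ S := fun S hS h => he S hS (M.subset_closure S hS.1 h)
  refine ⟨fun S => if S.ncard = p - 1 then insert e S else insert e (φ' S), ?_, ?_⟩
  · intro S hS
    dsimp only
    by_cases hcard : S.ncard = p - 1
    · rw [if_pos hcard]
      exact ⟨insert_mem_bigY_of_notMem_closure M heE hS (he S hS) hcard, subset_insert e S⟩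
    · rw [if_neg hcard]
      have hlt : S.ncard < p - 1 := by have := hS.2.2.2.1; omega
      have hS' := mem_lostSets_delete_of_notMem_closure M hE heE hS (he S hS) hlt
      obtain ⟨hT, hST⟩ := hφ' S hS'
      exact ⟨insert_mem_bigY_of_mem_bigY_delete' M heE hT, hST.trans (subset_insert e _)⟩
  · intro S₁ hS₁ S₂ hS₂ heq
    have he₁ : e ∉ S₁ := hnot S₁ hS₁
    have he₂ : e ∉ S₂ := hnot S₂ hS₂
    have hφe : ∀ S ∈ lostSets M p q, S.ncard < p - 1 → e ∉ φ' S := by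
      intro S hS hlt
      have hS' := mem_lostSets_delete_of_notMem_closure M hE heE hS (he S hS) hlt
      obtain ⟨⟨hTE, -, -⟩, -⟩ := (hφ' S hS').1
      rw [delete_ground] at hTE
      exact fun h => (hTE h).2 rfl
    have key : ∀ A B : Set α, e ∉ A → e ∉ B → insert e A = insert e B → A = B := by
      intro A B hA hB hAB
      have h1 : insert e A \ {e} = insert e B \ {e} := by rw [hAB]
      rwa [insert_sdiff_self_of_notMem hA, insert_sdiff_self_of_notMem hB] at h1
    simp only at heq
    by_cases h₁ : S₁.ncard = p - 1 <;> by_cases h₂ : S₂.ncard = p - 1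
    · rw [if_pos h₁, if_pos h₂] at heq
      exact key _ _ he₁ he₂ heq
    · rw [if_pos h₁, if_neg h₂] at heq
      have hlt₂ : S₂.ncard < p - 1 := by have := hS₂.2.2.2.1; omega
      have hS₂' := mem_lostSets_delete_of_notMem_closure M hE heE hS₂ (he S₂ hS₂) hlt₂
      have hA := key _ _ he₁ (hφe S₂ hS₂ hlt₂) heq
      obtain ⟨⟨hTE, hqT, -⟩, -⟩ := (hφ' S₂ hS₂').1
      rw [delete_ground] at hTE
      rw [eRk_delete_of_subset M hTE, ← hA, hS₁.2.1] at hqT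
      exact absurd hqT (lt_irrefl _)
    · rw [if_neg h₁, if_pos h₂] at heq
      have hlt₁ : S₁.ncard < p - 1 := by have := hS₁.2.2.2.1; omega
      have hS₁' := mem_lostSets_delete_of_notMem_closure M hE heE hS₁ (he S₁ hS₁) hlt₁
      have hA := key _ _ (hφe S₁ hS₁ hlt₁) he₂ heq
      obtain ⟨⟨hTE, hqT, -⟩, -⟩ := (hφ' S₁ hS₁').1
      rw [delete_ground] at hTE
      rw [eRk_delete_of_subset M hTE, hA, hS₂.2.1] at hqT
      exact absurd hqT (lt_irrefl _)
    · rw [if_neg h₁, if_neg h₂] at heq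
      have hlt₁ : S₁.ncard < p - 1 := by have := hS₁.2.2.2.1; omega
      have hlt₂ : S₂.ncard < p - 1 := by have := hS₂.2.2.2.1; omega
      have hA := key _ _ (hφe S₁ hS₁ hlt₁) (hφe S₂ hS₂ hlt₂) heq
      exact hinj' (mem_lostSets_delete_of_notMem_closure M hE heE hS₁ (he S₁ hS₁) hlt₁)
        (mem_lostSets_delete_of_notMem_closure M hE heE hS₂ (he S₂ hS₂) hlt₂) hA

/-- **(INJ) from a set of elements outside the closure of every fat rank-`q` set**: if `C ⊆ E` meets no closure
`cl S` of a set `S ⊆ E` with `r(S) = q < #S`, and `p ≤ q + 1 + #C`, then `(INJ)` holds at the tight layer `#E = p + q`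
(iterate `lostInj_of_notMem_closure` down to the vacuous cell `p ≤ q + 1`; the condition is stable under deletion). -/
theorem lostInj_of_fatFree (q : ℕ) : ∀ (p : ℕ) (M : Matroid α) [M.Finite] (C : Set α), C ⊆ M.E →
    (∀ S ⊆ M.E, M.eRk S = (q : ℕ∞) → q < S.ncard → Disjoint (M.closure S) C) →
    M.E.ncard = p + q → p ≤ q + 1 + C.ncard → LostInj M p q := by
  intro p
  induction p with
  | zero => intro M _ C _ _ _ _; exact lostInj_of_le M (by omega)
  | succ p ih =>
    intro M _ C hCE hC hE hcard
    by_cases hsmall : p + 1 ≤ q + 1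
    · exact lostInj_of_le M hsmall
    · have hCfin : C.Finite := (M.set_finite M.E).subset hCE
      have hCne : C.Nonempty := by
        by_contra hne
        rw [not_nonempty_iff_eq_empty] at hne
        rw [hne, ncard_empty] at hcard
        omega
      obtain ⟨e, heC⟩ := hCne
      have heE : e ∈ M.E := hCE heC
      refine lostInj_of_notMem_closure M hE heE ?_ ?_
      · intro S hS
        have hdisj := hC S hS.1 hS.2.1 hS.2.2.1
        exact fun h => (disjoint_left.1 hdisj) h heC
      · have h1 : (p + 1 - 1) = p := by omega
        rw [h1]
        refine ih (M ＼ {e}) (C \ {e}) ?_ ?_ ?_ ?_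
        · intro x hx
          rw [delete_ground]
          exact ⟨hCE hx.1, hx.2⟩
        · intro S hSE hSq hqS
          rw [delete_ground] at hSE
          rw [eRk_delete_of_subset M hSE] at hSq
          have hdisj := hC S (hSE.trans sdiff_subset) hSq hqS
          rw [delete_closure_eq_of_disjoint M (disjoint_singleton_right.2 (fun h => (hSE h).2 rfl))]
          exact (hdisj.mono_left sdiff_subset).mono_right sdiff_subset
        · rw [ncard_ground_delete M hE heE]; omega
        · rw [ncard_sdiff_singleton_of_mem heC]
          have : 1 ≤ C.ncard := by
            by_contra h0
            have h0' : C.ncard = 0 := by omega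
            rw [h0'] at hcard
            omega
          omega

/-- **The UP-Hall form of C-044 at the tight layer for every matroid with `p − q − 1` elements outside the closures of the
fat rank-`q` sets** — in particular for the uniform model `T_p(U_{q,q+m} ⊕ U_{c,c})` with `C` = the free elements. -/
theorem hallUp_of_ncard_eq_of_fatFree {p q : ℕ} (hE : M.E.ncard = p + q) (hpq : q < p) (C : Set α) (hCE : C ⊆ M.E)
    (hC : ∀ S ⊆ M.E, M.eRk S = (q : ℕ∞) → q < S.ncard → Disjoint (M.closure S) C) (hcard : p ≤ q + 1 + C.ncard) :
    ∀ 𝒜 ⊆ cellMembers M p q, phiK p q * (𝒜.ncard : ℚ) ≤ ((upNbhd M p q 𝒜).ncard : ℚ) :=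
  hallUp_of_ncard_eq_of_lostInj M p q hE hpq (lostInj_of_fatFree q p M C hCE hC hE hcard)

end PercRepro
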